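import Summits.Ventures.HSemireg.WedgeHankelRecurrenceKroneckerMinors

/-!
# Venture HSemireg — BPR THEOREM 9.17, THE REMAINING ARROWS THROUGH THE DETERMINANT CONDITION e): every rational digit sequence `q = dualSeq m b` (`m` monic, ANY numerator `b`) has a MINIMAL
# representation `q = dualSeq m₁ a` with `m₁` monic, `deg m₁ ≤ deg m`, `a` coprime to `m₁`, `deg m₁` = the eventual middle rank; hence **c) ⇒ e)** without a coprimality hypothesis (`r = deg m₁`),
# **a) ⇒ e)** (a monic recurrence of order `≤ d` ⇒ the condition e) for some `r ≤ d`) and the full circle **`(∃ monic recurrence of order ≤ d) ⟺ (∃ r ≤ d: han_r ≠ 0, han_n = 0 ∀ n > r)`**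

HONEST FRAMING. Part of the Lean index of the computation cell `pub-hsemireg` (seat p10 gen 37, Sunday typer «UNIFORM-IN-n»).
LINEAR ALGEBRA OF HANKEL MATRICES OVER A FIELD ONLY (`Matrix.rank ∕ det`; the lineage's `recSpace` ∕ `dualSeq` ∕ middle-rank vocabulary): no variety, no cohomology theory, no sheaf, no Ext group and no
semiregularity map is constructed here; nothing here says that HC / HC_CM / HC_AV holds; no Literature fact (unproved `Prop`) is declared or used.  Custodian versions as in `WedgeHankelSiegelIdeal` (1/3).
SOURCE OF THE ARGUMENT (cited; held text read, `book:basu2006-algorithms-real-algebraic-geometry` pp. 334–336): S. Basu, R. Pollack, M.-F. Roy, *Algorithms in Real Algebraic Geometry* (2006)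
§9.2.1 **Theorem 9.17** (a) linear recurrence of order `p`; c) `Q/P = Σ s_j/X^{j+1}` with `deg Q < deg P = p`; e) `∃ r ≤ p`, `han(s̄_r) ≠ 0`, `han(s̄_n) = 0` for `n > r`); the book proves
`a ⇒ c ⇒ b ⇒ a`, `a ⇒ d ⇒ e ⇒ a`; here the arrows INTO e) are obtained from the lineage's Kronecker theorem (N97 `WedgeHankelRecurrenceKronecker`: bounded middle ranks ⟺ rational ⟺ recurrent,
with the eventual rank = degree of the minimal recurrence) and N172's `c ⇒ e` for COPRIME data.
DEDUP DISCLOSURE (`rg` of the whole tree + Mathlib, 2026-09-01): N97 has `exists_eventually_rank_half_eq_natDegree` (minimal monic recurrence, eventual rank) and `forall_rank_half_le_iff_exists_dualSeq`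
(SOME denominator of degree `≤ d`, coprimality not recorded); N172 has e ⟺ d ⟺ c for COPRIME `(m, a)` and e ⇒ a; N101 ∕ N142 give ranks via `deg(m/gcd)`.  Not in the tree: the minimal
COPRIME representation of a rational sequence packaged with its eventual rank, and the arrows c ⇒ e (non-coprime), a ⇒ e — that is this file.  4 names: 0 hits tree-wide.

WHAT IS IN THE TREE.  N97: **`rank_half_dualSeq_le_natDegree`**, **`exists_eventually_rank_half_eq_natDegree`**, `forall_rank_half_le_iff_exists_dualSeq`, `forall_rank_half_le_iff_exists_recurrence`; N32:
**`exists_dualSeq_of_mem_recSpace`**, **`dualSeq_unique`**; N142: `rank_hankelSq_dualSeq_eq_natDegree_iff_isCoprime_of_le`; N48: `rank_hankelSq` (`rank H_t = R^{2t}`); N172: **`det_hankelSq_dualSeq_of_isCoprime`**,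
`exists_monic_forall_hkFun_eq_zero_of_det`.  Mathlib: `Polynomial.eq_one_of_monic_natDegree_zero`, `isCoprime_one_left`.
THIS FILE (namespace `Summit.Ventures.HSemireg.Wedge.HankelOuter` continued; CHAINED on N172 (+ N97 through it); 0 definitions):
* §822 **`exists_eq_dualSeq_isCoprime_of_eq_dualSeq`** (the minimal coprime representation + eventual rank), **`exists_det_condition_of_eq_dualSeq`** (c ⇒ e, any numerator),
  `exists_det_condition_of_forall_hkFun_eq_zero` (a ⇒ e), **`exists_forall_hkFun_eq_zero_iff_exists_det_condition`** (a ⟺ e with the bound `d`).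
CAVEATS.  All statements are over a field with `m` MONIC (the lineage's `dualSeq`); `r` is existential (the minimal order), as in BPR's e).  Nothing Ext-side.  New names only.
-/

open Module Polynomial
open scoped Matrix Polynomial

namespace Summit.Ventures.HSemireg.Wedge.HankelOuter

open Summit.Ventures.HSemireg.Wedge Summit.Ventures.HSemireg.Wedge.Hankel

section Rational

variable {K : Type*} [Field K]

/-! ## §822. Every rational digit sequence `b/m` (ANY numerator) satisfies BPR's determinant condition e) with `r` = the degree of its minimal monic denominator -/

/-- **The MINIMAL representation of a rational digit sequence: if `q = dualSeq m b` with `m` monic (any `b`), then `q = dualSeq m₁ a` with `m₁` monic of degree `≤ deg m`, `deg a < deg m₁`,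
`IsCoprime m₁ a`, and `deg m₁` is the eventual value of the middle ranks `R^N(q)`** (N97's persistence ∕ eventual-rank lemma glued over all windows by N32's uniqueness; coprimality read off
the full rank of a large section, N142). [this file, §822] -/
theorem exists_eq_dualSeq_isCoprime_of_eq_dualSeq {m b : K[X]} (hm : m.Monic) {q : ℕ → K} (hq : q = dualSeq K m b) :
    ∃ m₁ a : K[X], m₁.Monic ∧ m₁.natDegree ≤ m.natDegree ∧ a ∈ Polynomial.degreeLT K m₁.natDegree ∧ IsCoprime m₁ a ∧ q = dualSeq K m₁ a
      ∧ ∃ N₁, ∀ N, N₁ ≤ N → (hankel1 K N (N / 2) q).rank = m₁.natDegree := by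
  classical
  have hbound : ∀ N, (hankel1 K N (N / 2) q).rank ≤ m.natDegree := fun N => by rw [hq]; exact rank_half_dualSeq_le_natDegree K hm b N
  obtain ⟨N₁, m₁, hm₁, hm₁d, hconst, hrec⟩ := exists_eventually_rank_half_eq_natDegree K hbound
  -- one numerator for every window: take it on the window `[0, deg m₁]` and extend by uniqueness
  obtain ⟨a, ha, hqa⟩ := exists_dualSeq_of_mem_recSpace K hm₁ (hrec m₁.natDegree)
  have hall : ∀ j, q j = dualSeq K m₁ a j := fun j => by
    obtain ⟨a', ha', hqa'⟩ := exists_dualSeq_of_mem_recSpace K hm₁ (hrec (m₁.natDegree + j))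
    have haa : a' = a := dualSeq_unique K hm₁ (show m₁.natDegree ≤ m₁.natDegree + 1 by omega) ha' ha fun i hi => by rw [← hqa' i (by omega), hqa i hi]
    rw [hqa' j (by omega), haa]
  have hqa' : q = dualSeq K m₁ a := funext hall
  refine ⟨m₁, a, hm₁, hm₁d, ha, ?_, hqa', N₁, hconst⟩
  -- coprimality: a square section beyond `N₁` and of size `≥ deg m₁` has rank `deg m₁`
  rcases Nat.eq_zero_or_pos m₁.natDegree with h0 | hpos
  · rw [Polynomial.eq_one_of_monic_natDegree_zero hm₁ h0]; exact isCoprime_one_left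
  · obtain ⟨e, he⟩ : ∃ e, m₁.natDegree = e + 1 := ⟨m₁.natDegree - 1, by omega⟩
    set t := N₁ + e with htdef
    have hrk : (hankelSq K t q).rank = e + 1 := by rw [rank_hankelSq K t q, hconst (2 * t) (by omega), he]
    rw [hqa'] at hrk
    exact (rank_hankelSq_dualSeq_eq_natDegree_iff_isCoprime_of_le K hm₁ he (by omega) a).1 hrk

/-- **BPR THEOREM 9.17 c) ⇒ e) for an ARBITRARY representation: if `q = dualSeq m b` with `m` monic (no coprimality assumed), there is `r ≤ deg m` with `det H_{r−1}(q) ≠ 0` (void for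
`r = 0`) and `det H_n(q) = 0` for all `n ≥ r`** — namely `r` = the degree of the minimal denominator (§822 + N172 `det_hankelSq_dualSeq_of_isCoprime`). [this file, §822] -/
theorem exists_det_condition_of_eq_dualSeq {m b : K[X]} (hm : m.Monic) {q : ℕ → K} (hq : q = dualSeq K m b) :
    ∃ r, r ≤ m.natDegree ∧ (r = 0 ∨ (0 < r ∧ (hankelSq K (r - 1) q).det ≠ 0)) ∧ ∀ n, r ≤ n → (hankelSq K n q).det = 0 := by
  obtain ⟨m₁, a, hm₁, hm₁d, -, hc, hqa, -⟩ := exists_eq_dualSeq_isCoprime_of_eq_dualSeq hm hq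
  obtain ⟨h1, h2⟩ := det_hankelSq_dualSeq_of_isCoprime (K := K) hm₁ rfl hc
  exact ⟨m₁.natDegree, hm₁d, by rw [hqa]; exact h1, by rw [hqa]; exact h2⟩

/-- **BPR THEOREM 9.17 a) ⇒ e): a sequence with a monic linear recurrence of order `≤ d` at every shift satisfies the determinant condition e) for some `r ≤ d`** (N97
`forall_rank_half_le_iff_exists_recurrence` ∕ `…_iff_exists_dualSeq` + §822). [this file, §822] -/
theorem exists_det_condition_of_forall_hkFun_eq_zero {q : ℕ → K} {d : ℕ} (h : ∃ m : K[X], m.Monic ∧ m.natDegree ≤ d ∧ ∀ s, hkFun K q s m = 0) :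
    ∃ r, r ≤ d ∧ (r = 0 ∨ (0 < r ∧ (hankelSq K (r - 1) q).det ≠ 0)) ∧ ∀ n, r ≤ n → (hankelSq K n q).det = 0 := by
  obtain ⟨m, hm, hmd, a, -, hq⟩ := (forall_rank_half_le_iff_exists_dualSeq K q d).1 ((forall_rank_half_le_iff_exists_recurrence K q d).2 h)
  obtain ⟨r, hr, h1, h2⟩ := exists_det_condition_of_eq_dualSeq hm hq
  exact ⟨r, hr.trans hmd, h1, h2⟩

/-- **BPR THEOREM 9.17, the full circle through e): `(∃ monic recurrence of order ≤ d) ⟺ (∃ r ≤ d, det H_{r−1}(q) ≠ 0 ∧ ∀ n ≥ r, det H_n(q) = 0)`.** [this file, §822] -/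
theorem exists_forall_hkFun_eq_zero_iff_exists_det_condition (q : ℕ → K) (d : ℕ) :
    (∃ m : K[X], m.Monic ∧ m.natDegree ≤ d ∧ ∀ s, hkFun K q s m = 0) ↔ ∃ r, r ≤ d ∧ (r = 0 ∨ (0 < r ∧ (hankelSq K (r - 1) q).det ≠ 0)) ∧ ∀ n, r ≤ n → (hankelSq K n q).det = 0 := by
  refine ⟨exists_det_condition_of_forall_hkFun_eq_zero, fun ⟨r, hr, h1, h2⟩ => ?_⟩
  obtain ⟨m, hm, hmd, hrec⟩ := exists_monic_forall_hkFun_eq_zero_of_det q h1 h2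
  exact ⟨m, hm, hmd.le.trans hr, hrec⟩

end Rational

end Summit.Ventures.HSemireg.Wedge.HankelOuter
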